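import Summits.Ventures.YMGap.RobustBall.TorusDoor
import Literature.Probability.LatticeModels.DobrushinMetricWeightedDecay
import HarnessLib

/-!
# Venture YMGap, track ROBUST-BALL (Y2) — torus-uniform exponential clustering on the ball (targets C-MGT
and C-MGT-W of `RobustBall/Targets`; the `β⋆`-uniform currency `TorusClusteringOnBallUpTo`)

HONEST FRAMING. WHAT THIS IS: a venture file (cell `pub-ymgap`, track Y2 ROBUST-BALL, seat ds-2): the
CLUSTERING HALF of the robust torus door. (i) **C-MGT** `clusteringFromDoorTarget_holds`: a tier-1 robust
torus door `RobustTorusDoor N d β ε₀ ε₁ r ρ` with `0 < ρ < 1` gives, on every torus `L ≥ 3` and for every member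
`W` of `ClusterDomainFR ε₀ ε₁ r`, exponential clustering of bounded measurable Lipschitz cylinder observables
under the member's measure `μ_{β,W,L} = W.perturbedMeasure (fundamentalRep (Fin N)) β`:
`|cov(f,g)| ≤ 8N (∑ δ_g)(∑ δ_f) e^{−m·n}`, `m = −log ρ / (r ⊔ 1)`, `n` = torus distance of the supports —
Föllmer's comparison estimate `abs_covariance_le_of_isKRContraction` for the Gibbs measure `μ_{β,W,L}` of
`perturbedTorusSpec W β` (`isGibbsMeasure_perturbedMeasure`) with the CEILING profile
`ℓ(y) = ⌈dist(y, Δ_g)/(r ⊔ 1)⌉` (drops by at most one along neighbourhoods of range `≤ r ⊔ 1`, so the constant is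
exactly `2(2√N)² = 8N` and the rate exactly `−log ρ/(r ⊔ 1)`). (ii) **C-MGT-W**
`clusteringFromWeightedDoorTarget_holds`: a tier-2 door with rows weighted by `e^{t‖e−y‖_∞}` at most `ρ < 1`
gives clustering at rate `t` with the same constant — lit-1's weighted engine
`abs_covariance_le_of_isKRContraction_exp_dist` (Föllmer 1988 Cor. (2.14)/(2.24); crux Y2-X1a, in the tree)
with the profile `dist(·, Δ_g)`. (iii) Assembled currencies from a one-link modulus BY NAME:
`torusClusteringOnBall_of_oneLinkKRModulus`, the `β⋆`-uniform `torusClusteringOnBallUpTo_of_oneLinkKRModulus`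
(ym3ir-theory-1's receiving currency: the Wilson constant is monotone in `β`, the loads are `β`-free) and the
tier-2 `torusClusteringOnBallW_of_oneLinkKRModulus`.
WHAT THIS IS NOT: no certified row (the `SU(2)`, `d = 4` rows are a separate ≤ 100-line file on the tree's
quarter modulus), no `ℤ^d` / DLR statement (rb-p1's `RobustMassGapDoor`), no area law; strong-coupling
LATTICE statements on finite tori, uniform in the volume — no continuum, no Millennium claim.

## References
* H. Föllmer, LNM 1362 (1988), Ch. I Thm. (2.13), Cor. (2.14), Remark (2.17), (2.20)–(2.24).
* H.-O. Georgii, *Gibbs Measures and Phase Transitions* (2011), Thm. 8.20, Remark 8.26.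
* H. Künsch, CMP 84 (1982) 207.
* The tree: `DobrushinMetricStates.lean` (`abs_covariance_le_of_isKRContraction`), lit-1's
  `DobrushinMetricWeightedDecay.lean` (`abs_covariance_le_of_isKRContraction_exp_dist`),
  `StrongCouplingTorusWindow.lean` (`wilson_torusClustering_of_oneLinkKRModulus`, the `W = 0` template).
-/

noncomputable section

open MeasureTheory ProbabilityTheory Finset Function Real
open Literature.Probability.LatticeModels Literature.Probability.LatticeModels.DobrushinMetric
open Literature.MathematicalPhysics.QuantumLattice hiding torusNorm
open Literature.MathematicalPhysics.QuantumFieldTheory hiding ZdEdge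
open Literature.MathematicalPhysics.QuantumFieldTheory.Balaban1983to89.StrongCouplingTorusWindow
open Literature.MathematicalPhysics.QuantumFieldTheory.Balaban1983to89.StrongCouplingDobrushinWindow
  (OneLinkKRModulus)

namespace Summit.Ventures.YMGap.RobustBall

variable {d L N : ℕ} [NeZero L]

/-! ### The distance-to-the-support profile -/

section Profile

variable (Δg : Finset (Edge d L)) (n : ℕ)

omit [NeZero L] in
/-- The profile vanishes on the support: `dist(y, Δ_g) = 0` for `y ∈ Δ_g`. [folklore] -/
theorem distProfile_eq_zero_of_mem {y : Edge d L} (hy : y ∈ Δg) :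
    (if h : Δg.Nonempty then Δg.inf' h (fun z => torusNorm (y.1 - z.1)) else n) = 0 := by
  rw [dif_pos ⟨y, hy⟩]
  exact Nat.le_zero.1 ((Finset.inf'_le _ hy).trans (by simp))

omit [NeZero L] in
/-- The profile is `1`-Lipschitz for the torus distance of base points:
`dist(x, Δ_g) ≤ dist(y, Δ_g) + ‖x − y‖_∞`. [folklore] -/
theorem distProfile_le_add (x y : Edge d L) :
    (if h : Δg.Nonempty then Δg.inf' h (fun z => torusNorm (x.1 - z.1)) else n) ≤
      (if h : Δg.Nonempty then Δg.inf' h (fun z => torusNorm (y.1 - z.1)) else n) + torusNorm (x.1 - y.1) := by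
  by_cases h : Δg.Nonempty
  · rw [dif_pos h, dif_pos h]
    obtain ⟨z, hz, hzeq⟩ := Finset.exists_mem_eq_inf' h (fun z => torusNorm (y.1 - z.1))
    rw [hzeq]
    exact (Finset.inf'_le _ hz).trans ((torusNorm_sub_le x.1 y.1 z.1).trans (by omega))
  · rw [dif_neg h, dif_neg h]
    exact Nat.le_add_right _ _

omit [NeZero L] in
/-- Separation of the supports bounds the profile from below on `Δ_f`. [folklore] -/
theorem le_distProfile_of_sep {Δf : Finset (Edge d L)} (hsep : ∀ x ∈ Δf, ∀ y ∈ Δg, n ≤ torusNorm (x.1 - y.1))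
    {x : Edge d L} (hx : x ∈ Δf) :
    n ≤ (if h : Δg.Nonempty then Δg.inf' h (fun z => torusNorm (x.1 - z.1)) else n) := by
  by_cases h : Δg.Nonempty
  · rw [dif_pos h]
    exact Finset.le_inf' _ _ fun z hz => hsep x hx z hz
  · rw [dif_neg h]

end Profile

/-! ### C-MGT: clustering from the tier-1 door -/

section Clustering

/-- `2 (2√N)² = 8N`. [folklore] -/
theorem two_mul_sq_two_sqrt (N : ℕ) : 2 * (2 * Real.sqrt (N : ℝ)) ^ 2 = 8 * (N : ℝ) := by
  rw [mul_pow, Real.sq_sqrt (Nat.cast_nonneg N)]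
  ring

/-- **Clustering of a member from Dobrushin's condition with finite-range neighbourhoods.** If the perturbed
torus specification of `W` is a KR contraction over neighbourhoods of range `≤ r₁` (`r₁ ≥ 1`) with row sums
`≤ ρ`, `0 < ρ ≤ 1`, then `W` clusters at tree coupling `β` with constant `8N` and rate `−log ρ / r₁`:
Föllmer's comparison estimate for the Gibbs measure `μ_{β,W,L}` with the ceiling profile `⌈dist(·, Δ_g)/r₁⌉`. [folklore] -/
theorem clustersWith_of_isKRContraction {W : Perturbation d L N} {β : ℝ} {nbr : Edge d L → Finset (Edge d L)}
    {C : Edge d L → Edge d L → ℝ} (hKR : IsKRContraction (perturbedTorusSpec W β) suFrobDist nbr C) {ρ : ℝ}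
    (hρ0 : 0 < ρ) (hρ1 : ρ ≤ 1) (hrow : ∀ e, ∑ y ∈ nbr e, C e y ≤ ρ) {r₁ : ℕ} (hr₁ : 1 ≤ r₁)
    (hnbr : ∀ e, ∀ y ∈ nbr e, torusNorm (e.1 - y.1) ≤ r₁) :
    ClustersWith W β (8 * N) (-Real.log ρ / r₁) := by
  classical
  intro f g Δf Δg δf δg n hfm hgm hfdep hgdep hfb hgb hδf hδg hsep
  obtain ⟨Mf, hMf⟩ := hfb
  obtain ⟨Mg, hMg⟩ := hgb
  have hγ := isSpecification_perturbedTorusSpec W β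
  have hG := isGibbsMeasure_perturbedMeasure W β
  have hD : (0 : ℝ) ≤ 2 * Real.sqrt N := by positivity
  have hr₁0 : (0 : ℝ) < r₁ := by exact_mod_cast hr₁
  -- the ceiling profile
  set D : Edge d L → ℕ := fun y => if h : Δg.Nonempty then Δg.inf' h (fun z => torusNorm (y.1 - z.1)) else n
    with hDdef
  set ℓ : Edge d L → ℕ := fun y => ⌈(D y : ℝ) / r₁⌉₊ with hℓdef
  have hℓ0 : ∀ y ∈ Δg, ℓ y = 0 := fun y hy => by
    simp only [hℓdef, hDdef, distProfile_eq_zero_of_mem Δg n hy, Nat.cast_zero, zero_div, Nat.ceil_zero]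
  have hℓ : ∀ x ∉ Δg, ∀ y ∈ nbr x, ℓ x ≤ ℓ y + 1 := by
    intro x _ y hy
    have h1 : (D x : ℝ) / r₁ ≤ (D y : ℝ) / r₁ + 1 := by
      have hle : (D x : ℝ) ≤ D y + r₁ := by
        have := (distProfile_le_add Δg n x y).trans (Nat.add_le_add_left (hnbr x y hy) _)
        exact_mod_cast this
      rw [div_add_one hr₁0.ne', div_le_div_iff_of_pos_right hr₁0]
      exact hle
    calc ℓ x ≤ ⌈(D y : ℝ) / r₁ + 1⌉₊ := Nat.ceil_mono h1
      _ = ℓ y + 1 := Nat.ceil_add_one (by positivity)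
  have key := abs_covariance_le_of_isKRContraction hγ hKR (r := suFrobDist) (R := 2 * Real.sqrt N)
    suFrobDist_nonneg suFrobDist_le hD hρ0.le hρ1 hrow hG hfm hfdep hMf hδf hgm hgdep hMg hδg ℓ hℓ0 hℓ
  refine key.trans ?_
  -- on `Δf` the profile is `≥ n / r₁`, so `ρ^{ℓ y} ≤ exp(−m n)`
  have hpow : ∀ y ∈ Δf, ρ ^ ℓ y ≤ Real.exp (-(-Real.log ρ / r₁) * n) := by
    intro y hy
    have hny : (n : ℝ) / r₁ ≤ ℓ y := by
      have h1 : (n : ℝ) / r₁ ≤ (D y : ℝ) / r₁ :=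
        div_le_div_of_nonneg_right (by exact_mod_cast le_distProfile_of_sep Δg n hsep hy) hr₁0.le
      exact h1.trans (Nat.le_ceil _)
    rw [← Real.rpow_natCast, Real.rpow_def_of_pos hρ0]
    refine Real.exp_le_exp.2 ?_
    have hlog : Real.log ρ ≤ 0 := Real.log_nonpos hρ0.le hρ1
    calc Real.log ρ * (ℓ y : ℝ) ≤ Real.log ρ * ((n : ℝ) / r₁) := mul_le_mul_of_nonpos_left hny hlog
      _ = -(-Real.log ρ / r₁) * n := by ring
  have hsum : ∑ y ∈ Δf, ρ ^ ℓ y * δf y ≤ ∑ y ∈ Δf, Real.exp (-(-Real.log ρ / r₁) * n) * δf y :=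
    Finset.sum_le_sum fun y hy => mul_le_mul_of_nonneg_right (hpow y hy) (hδf.nonneg y)
  have hδg0 : 0 ≤ ∑ y ∈ Δg, δg y := Finset.sum_nonneg fun y _ => hδg.nonneg y
  calc 2 * (2 * Real.sqrt N) ^ 2 * (∑ y ∈ Δg, δg y) * ∑ y ∈ Δf, ρ ^ ℓ y * δf y
      ≤ 2 * (2 * Real.sqrt N) ^ 2 * (∑ y ∈ Δg, δg y) * ∑ y ∈ Δf, Real.exp (-(-Real.log ρ / r₁) * n) * δf y :=
        mul_le_mul_of_nonneg_left hsum (mul_nonneg (by positivity) hδg0)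
    _ = 8 * N * (∑ y ∈ Δg, δg y) * (∑ x ∈ Δf, δf x) * Real.exp (-(-Real.log ρ / r₁) * n) := by
        rw [two_mul_sq_two_sqrt, ← Finset.mul_sum]; ring

/-- **C-MGT — clustering on the tier-1 ball from the robust torus door**: `RobustTorusDoor N d β ε₀ ε₁ r ρ` with
`0 < ρ < 1` gives `TorusClusteringOnBall N d β ε₀ ε₁ r (8N) (−log ρ / (r ⊔ 1))`. [folklore] -/
theorem clusteringFromDoorTarget_holds (N d : ℕ) (β ε₀ ε₁ ρ : ℝ) (r : ℕ) :
    ClusteringFromDoorTarget N d β ε₀ ε₁ ρ r := by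
  intro hdoor hρ0 hρ1 L _ hL W hW
  obtain ⟨nbr, C, hKR, hrow, hnbr⟩ := hdoor L hL W hW
  have h := clustersWith_of_isKRContraction hKR hρ0 hρ1.le hrow (r₁ := max r 1) (le_max_right _ _) hnbr
  simpa [Nat.cast_max] using h

/-! ### C-MGT-W: clustering from the tier-2 (weighted) door -/

/-- **Clustering of a member from Dobrushin's condition with WEIGHTED rows** (`∑_y C(e,y) e^{t‖e−y‖_∞} ≤ ρ < 1`,
`t ≥ 0`): rate `t` per lattice unit, constant `8N` — lit-1's weighted engine with the profile `dist(·, Δ_g)`. [folklore] -/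
theorem clustersWith_of_isKRContraction_weighted {W : Perturbation d L N} {β : ℝ} {nbr : Edge d L → Finset (Edge d L)}
    {C : Edge d L → Edge d L → ℝ} (hKR : IsKRContraction (perturbedTorusSpec W β) suFrobDist nbr C) {t ρ : ℝ}
    (ht : 0 ≤ t) (hρ0 : 0 ≤ ρ) (hρ1 : ρ < 1)
    (hroww : ∀ e, ∑ y ∈ nbr e, C e y * Real.exp (t * torusNorm (e.1 - y.1)) ≤ ρ) :
    ClustersWith W β (8 * N) t := by
  classical
  intro f g Δf Δg δf δg n hfm hgm hfdep hgdep hfb hgb hδf hδg hsep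
  obtain ⟨Mf, hMf⟩ := hfb
  obtain ⟨Mg, hMg⟩ := hgb
  have hγ := isSpecification_perturbedTorusSpec W β
  have hG := isGibbsMeasure_perturbedMeasure W β
  have hD : (0 : ℝ) ≤ 2 * Real.sqrt N := by positivity
  set D : Edge d L → ℝ := fun y =>
    ((if h : Δg.Nonempty then Δg.inf' h (fun z => torusNorm (y.1 - z.1)) else n : ℕ) : ℝ) with hDdef
  have hDg : ∀ y ∈ Δg, D y ≤ 0 := fun y hy => by
    simp only [hDdef, distProfile_eq_zero_of_mem Δg n hy, Nat.cast_zero, le_refl]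
  have hDle : ∀ x ∉ Δg, ∀ y ∈ nbr x, D x ≤ D y + (torusNorm (x.1 - y.1) : ℝ) := fun x _ y _ => by
    simp only [hDdef]
    exact_mod_cast distProfile_le_add Δg n x y
  have hm : ∀ y ∈ Δf, (n : ℝ) ≤ D y := fun y hy => by
    simp only [hDdef]
    exact_mod_cast le_distProfile_of_sep Δg n hsep hy
  have key := abs_covariance_le_of_isKRContraction_exp_dist hγ hKR (r := suFrobDist) (R := 2 * Real.sqrt N)
    suFrobDist_nonneg suFrobDist_le hD hG hfm hfdep hMf hδf hgm hgdep hMg hδg hρ0 hρ1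
    (fun x y => (torusNorm (x.1 - y.1) : ℝ)) (fun x _ y _ => Nat.cast_nonneg _) ht (fun x _ => hroww x) D hDg hDle hm
  refine key.trans (le_of_eq ?_)
  rw [two_mul_sq_two_sqrt]
  ring

/-- **C-MGT-W — clustering on the tier-2 ball from the weighted robust torus door**. [folklore] -/
theorem clusteringFromWeightedDoorTarget_holds (N d : ℕ) (β κ ε₀ ε₁ t ρ : ℝ) :
    ClusteringFromWeightedDoorTarget N d β κ ε₀ ε₁ t ρ := by
  intro hdoor ht hρ0 hρ1 L _ hL W hW
  obtain ⟨nbr, C, hKR, hroww⟩ := hdoor L hL W hW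
  exact clustersWith_of_isKRContraction_weighted hKR ht hρ0 hρ1 hroww

/-! ### The currencies from a one-link modulus by name -/

/-- `rhoFR` is monotone in the Wilson constant (for `ε₁ ≥ 0`). [folklore] -/
theorem rhoFR_mono {cW cW' ε₀ ε₁ : ℝ} (h : cW ≤ cW') (hε₁ : 0 ≤ ε₁) : rhoFR N cW ε₀ ε₁ ≤ rhoFR N cW' ε₀ ε₁ := by
  unfold rhoFR
  have h1 : 0 ≤ Real.exp ε₀ * (1 + 2 * Real.sqrt N * ε₁) := by positivity
  exact max_le_max (mul_le_mul_of_nonneg_left h h1)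
    (add_le_add (mul_le_mul_of_nonneg_left h (Real.exp_pos _).le) le_rfl)

/-- A robust torus door with a smaller row bound is one with a larger row bound. [folklore] -/
theorem RobustTorusDoor.mono {β ε₀ ε₁ ρ ρ' : ℝ} {r : ℕ} (h : RobustTorusDoor N d β ε₀ ε₁ r ρ) (hle : ρ ≤ ρ') :
    RobustTorusDoor N d β ε₀ ε₁ r ρ' := fun L _ hL W hW => by
  obtain ⟨nbr, C, hKR, hrow, hnbr⟩ := h L hL W hW
  exact ⟨nbr, C, hKR, fun e => (hrow e).trans hle, hnbr⟩

/-- **Torus clustering on the tier-1 ball from a one-link modulus by name** (`d, N ≥ 1`): with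
`ρ = rhoFR N (K (|β|/N) 6(d−1)) ε₀ ε₁ ∈ (0, 1)`, every member of `ClusterDomainFR ε₀ ε₁ r` on every torus `L ≥ 3`
clusters with constant `8N` and rate `−log ρ / (r ⊔ 1)`. [folklore] -/
theorem torusClusteringOnBall_of_oneLinkKRModulus (hd : 1 ≤ d) (hN : 1 ≤ N) {β ε₀ ε₁ R K : ℝ} (hK : 0 ≤ K)
    (hR : |β| / N * (2 * ((d : ℝ) - 1)) ≤ R) (hmod : OneLinkKRModulus N R K) (hε₀ : 0 ≤ ε₀) (hε₁ : 0 ≤ ε₁) (r : ℕ)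
    (hρ0 : 0 < rhoFR N (K * (|β| / N) * (6 * ((d : ℝ) - 1))) ε₀ ε₁)
    (hρ1 : rhoFR N (K * (|β| / N) * (6 * ((d : ℝ) - 1))) ε₀ ε₁ < 1) :
    TorusClusteringOnBall N d β ε₀ ε₁ r (8 * N)
      (-Real.log (rhoFR N (K * (|β| / N) * (6 * ((d : ℝ) - 1))) ε₀ ε₁) / max r 1) :=
  clusteringFromDoorTarget_holds N d β ε₀ ε₁ _ r (robustTorusDoorTarget_holds hd hN β ε₀ ε₁ R K r hK hR hmod hε₀ hε₁)
    hρ0 hρ1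

/-- **The `β⋆`-uniform currency from a one-link modulus by name** (ym3ir-theory-1's receiving type): for
`0 ≤ β ≤ β⋆` the radius `(|β|/N) 2(d−1)` and the Wilson constant `K (|β|/N) 6(d−1)` are monotone in `β` and the
loads are `β`-free, so ONE modulus on the radius at `β⋆` and ONE row bound `ρ⋆ = rhoFR N (K (β⋆/N) 6(d−1)) ε₀ ε₁ < 1`
serve the whole interval: `TorusClusteringOnBallUpTo N d β⋆ ε₀ ε₁ r (8N) (−log ρ⋆ / (r ⊔ 1))`. [folklore] -/
theorem torusClusteringOnBallUpTo_of_oneLinkKRModulus (hd : 1 ≤ d) (hN : 1 ≤ N) {βs ε₀ ε₁ R K : ℝ} (hK : 0 ≤ K)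
    (hR : βs / N * (2 * ((d : ℝ) - 1)) ≤ R) (hmod : OneLinkKRModulus N R K) (hε₀ : 0 ≤ ε₀)
    (hε₁ : 0 ≤ ε₁) (r : ℕ) (hρ0 : 0 < rhoFR N (K * (βs / N) * (6 * ((d : ℝ) - 1))) ε₀ ε₁)
    (hρ1 : rhoFR N (K * (βs / N) * (6 * ((d : ℝ) - 1))) ε₀ ε₁ < 1) :
    TorusClusteringOnBallUpTo N d βs ε₀ ε₁ r (8 * N)
      (-Real.log (rhoFR N (K * (βs / N) * (6 * ((d : ℝ) - 1))) ε₀ ε₁) / max r 1) := by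
  intro β hβ0 hββs
  have hd1 : (0 : ℝ) ≤ (d : ℝ) - 1 := by
    have : (1 : ℝ) ≤ d := by exact_mod_cast hd
    linarith
  have hN0 : (0 : ℝ) < N := by exact_mod_cast (show 0 < N by omega)
  have hβabs : |β| = β := abs_of_nonneg hβ0
  have hRβ : |β| / N * (2 * ((d : ℝ) - 1)) ≤ R := by
    rw [hβabs]
    exact le_trans (mul_le_mul_of_nonneg_right (div_le_div_of_nonneg_right hββs hN0.le) (by positivity)) hR
  have hcW : K * (|β| / N) * (6 * ((d : ℝ) - 1)) ≤ K * (βs / N) * (6 * ((d : ℝ) - 1)) := by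
    rw [hβabs]
    exact mul_le_mul_of_nonneg_right (mul_le_mul_of_nonneg_left (div_le_div_of_nonneg_right hββs hN0.le) hK)
      (by positivity)
  have hdoor := (robustTorusDoorTarget_holds hd hN β ε₀ ε₁ R K r hK hRβ hmod hε₀ hε₁).mono (rhoFR_mono hcW hε₁)
  exact clusteringFromDoorTarget_holds N d β ε₀ ε₁ _ r hdoor hρ0 hρ1

/-- **Torus clustering on the tier-2 ball from a one-link modulus by name** (`d, N ≥ 1`, `κ ≥ 0`): with
`ρ = rhoFR N (e^{κ} K (|β|/N) 6(d−1)) ε₀ ε₁ < 1`, every member of the diameter-weighted ball `ClusterDomain κ ε₀ ε₁`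
on every torus `L ≥ 3` clusters with constant `8N` and rate `κ`. [folklore] -/
theorem torusClusteringOnBallW_of_oneLinkKRModulus (hd : 1 ≤ d) (hN : 1 ≤ N) {β κ ε₀ ε₁ R K : ℝ} (hK : 0 ≤ K)
    (hκ : 0 ≤ κ) (hR : |β| / N * (2 * ((d : ℝ) - 1)) ≤ R) (hmod : OneLinkKRModulus N R K) (hε₀ : 0 ≤ ε₀)
    (hε₁ : 0 ≤ ε₁) (hρ1 : rhoFR N (Real.exp κ * K * (|β| / N) * (6 * ((d : ℝ) - 1))) ε₀ ε₁ < 1) :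
    TorusClusteringOnBallW N d β κ ε₀ ε₁ (8 * N) κ := by
  have hd1 : (0 : ℝ) ≤ (d : ℝ) - 1 := by
    have : (1 : ℝ) ≤ d := by exact_mod_cast hd
    linarith
  have hρ0 : 0 ≤ rhoFR N (Real.exp κ * K * (|β| / N) * (6 * ((d : ℝ) - 1))) ε₀ ε₁ :=
    le_trans (by positivity) (le_max_left _ _)
  exact clusteringFromWeightedDoorTarget_holds N d β κ ε₀ ε₁ κ _
    (robustTorusDoorWTarget_holds hd hN β κ ε₀ ε₁ R K hK hκ hR hmod hε₀ hε₁) hκ hρ0 hρ1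

/-- Consistency (T1.3): at `W = 0` the member's measure is the torus Wilson measure, so every clustering
statement on the ball contains the Wilson one. [folklore] -/
theorem clustersWith_zero_iff {β A m : ℝ} :
    ClustersWith (0 : Perturbation d L N) β A m ↔
      ∀ (f g : GaugeConfig d L (SUN N) → ℝ) (Δf Δg : Finset (Edge d L)) (δf δg : Edge d L → ℝ) (n : ℕ),
        Measurable f → Measurable g → DependsOn f (↑Δf : Set (Edge d L)) →
        DependsOn g (↑Δg : Set (Edge d L)) → (∃ M, ∀ U, |f U| ≤ M) → (∃ M, ∀ U, |g U| ≤ M) →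
        IsLipBound suFrobDist f δf → IsLipBound suFrobDist g δg →
        (∀ x ∈ Δf, ∀ y ∈ Δg, n ≤ torusNorm (x.1 - y.1)) →
          |cov[f, g; wilsonMeasure (d := d) (L := L) (fundamentalRep (Fin N)) β]| ≤
            A * (∑ y ∈ Δg, δg y) * (∑ x ∈ Δf, δf x) * Real.exp (-m * n) := by
  unfold ClustersWith
  rw [QuasiLocalGaugePerturbation.perturbedMeasure_zero]

end Clustering

end Summit.Ventures.YMGap.RobustBall

end
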